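import Literature.MathematicalPhysics.QuantumLattice.FlowWeightedLiebRobinsonProofs
import HarnessLib

/-!
# The flow Lieb–Robinson bound with the coupling extracted

Top-down layer (seat B) of the formalisation of the Michalakis–Zwolak stability theorem
(hubbard.S19, `Literature.MathematicalPhysics.QuantumLattice.michalakis_zwolak`). The generator of
Hastings' spectral flow for `H_s = H₀ + s ε V` is `O(ε)`: its size-weighted local norm is
`≤ |ε| J` with `J` independent of `ε`. Seat A's `norm_comm_flow_le_exp_weighted` then bounds
`‖[α_s(A), B]‖` by `2‖A‖‖B‖ #X (exp(−μ δX + 2e^μ |ε|J s) + κ exp(2|ε|Js))`, which does not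
vanish with `ε`; but the iterated form `norm_comm_flow_le_iterate_weighted` does — every term of
its series carries at least one factor `2|ε|Js`. `norm_comm_flow_le_exp_weighted_scaled` records the
resulting bound `2‖A‖‖B‖ #X · a · (exp(−μ δX + 2e^μ J s) + κ exp(2Js))` for local norms `≤ aJ`,
`0 ≤ a ≤ 1` (the `O(s‖V‖)`-smallness of `α_s − id` of MZ13 Lemma 2, "`‖𝓤(r'; O)‖ ≤ J‖O‖g(r')`",
arXiv:1109.1588 p. 12, with `J ∝ ε`). No definitions, no named facts (theorems only).
-/

noncomputable section

open Matrix Complex Set Filter MeasureTheory Topology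
open scoped Nat
open scoped Matrix Matrix.Norms.L2Operator Topology

namespace Literature.MathematicalPhysics.QuantumLattice

section Lattice

open Finset

variable {Λ : Type*} [Fintype Λ] [DecidableEq Λ] {q : ℕ}

/-- Terms of the exponential series with a small coupling: for `0 ≤ a ≤ 1`, `x ≥ 0` and `n ≥ 1`,
`(a x)ⁿ/n! ≤ a · xⁿ/n!`. [folklore] -/
theorem pow_mul_div_factorial_le_mul {a x : ℝ} (ha0 : 0 ≤ a) (ha1 : a ≤ 1) (hx : 0 ≤ x) {n : ℕ}
    (hn : 1 ≤ n) : (a * x) ^ n / n ! ≤ a * (x ^ n / n !) := by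
  rw [mul_pow, mul_div_assoc]
  exact mul_le_mul_of_nonneg_right (pow_le_of_le_one ha0 ha1 (by omega)) (by positivity)

/-- Partial sums of the exponential series with a small coupling: for `0 ≤ a ≤ 1`, `x ≥ 0` and
`1 ≤ m`, `Σ_{n=m}^{M} (a x)ⁿ/n! ≤ a Σ_{n=m}^{M} xⁿ/n!`. [folklore] -/
theorem sum_Icc_pow_mul_div_factorial_le_mul {a x : ℝ} (ha0 : 0 ≤ a) (ha1 : a ≤ 1) (hx : 0 ≤ x)
    {m : ℕ} (hm : 1 ≤ m) (M : ℕ) :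
    ∑ n ∈ Finset.Icc m M, (a * x) ^ n / n ! ≤ a * ∑ n ∈ Finset.Icc m M, x ^ n / n ! := by
  rw [Finset.mul_sum]
  exact Finset.sum_le_sum fun n hn =>
    pow_mul_div_factorial_le_mul ha0 ha1 hx (hm.trans (Finset.mem_Icc.mp hn).1)

/-- **Lieb–Robinson bound for the flow of a quasi-local generator with a small coupling.** Under
the hypotheses of `norm_comm_flow_le_iterate_weighted` with size-weighted local norms `≤ a J` and
long-range part `≤ κ (a J)`, `0 ≤ a ≤ 1`, for `A ∈ 𝔄_X` with `δ X ≥ 1`, `0 ≤ μ`, `s ∈ [0, T]`: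
`‖[α_s(A), B]‖ ≤ 2‖A‖‖B‖ #X · a · (exp(−μ δX + 2e^μ J s) + κ exp(2Js))` — the bound of
`norm_comm_flow_le_exp_weighted` at coupling `1`, times `a`. [cite: MichalakisZwolakCMP2013, §5.2 Lemma 2 (arXiv:1109.1588 p. 12)] -/
theorem norm_comm_flow_le_exp_weighted_scaled {Ψ : ℝ → Interaction Λ q} (hΨ : ∀ s, (Ψ s).IsLocal)
    {T : ℝ} (hΨc : ∀ Z, ContinuousOn (fun s => Ψ s Z) (Icc 0 T)) {U : ℝ → Op Λ q} (hU0 : U 0 = 1)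
    (hU : ∀ s ∈ Icc 0 T,
      HasDerivWithinAt U (((I : ℂ) • localHamiltonian (Ψ s) univ) * U s) (Icc 0 T) s)
    (hU1 : ∀ s ∈ Icc 0 T, (U s)ᴴ * U s = 1) (hU2 : ∀ s ∈ Icc 0 T, U s * (U s)ᴴ = 1)
    {R : Finset Λ → Prop} [DecidablePred R]
    {X Y : Finset Λ} {A B : Op Λ q} (hA : IsSupportedOn A X) (hB : IsSupportedOn B Y)
    (δ : Finset Λ → ℕ) (hδY : ∀ Z, 0 < δ Z → Disjoint Z Y)
    (hδ : ∀ Z Z', R Z' → ¬ Disjoint Z' Z → δ Z ≤ δ Z' + 1) (hX : 0 < δ X) {J a : ℝ} (hJ0 : 0 ≤ J)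
    (ha0 : 0 ≤ a) (ha1 : a ≤ 1)
    (hJ : ∀ s ∈ Icc 0 T, ∀ x : Λ, ∑ Z ∈ univ.filter (fun Z : Finset Λ => x ∈ Z),
      (#Z : ℝ) * ‖Ψ s Z‖ ≤ a * J)
    {κ : ℝ} (hκ : 0 ≤ κ)
    (hJ' : ∀ s ∈ Icc 0 T, ∀ x : Λ, ∑ Z ∈ univ.filter (fun Z : Finset Λ => x ∈ Z),
      ‖(if R Z then (0 : Op Λ q) else Ψ s Z)‖ ≤ κ * (a * J))
    {μ : ℝ} (hμ : 0 ≤ μ) {s : ℝ} (hs : s ∈ Icc 0 T) :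
    ‖(U s)ᴴ * A * U s * B - B * ((U s)ᴴ * A * U s)‖ ≤
      2 * ‖A‖ * ‖B‖ * #X * a * (Real.exp (-(μ * δ X) + 2 * Real.exp μ * J * s) +
        κ * Real.exp (2 * J * s)) := by
  set c : ℝ := 2 * J with hc
  have hc0 : 0 ≤ c := by rw [hc]; positivity
  have hcs : 0 ≤ c * s := mul_nonneg hc0 hs.1
  have haJ0 : 0 ≤ a * J := mul_nonneg ha0 hJ0
  set L : ℝ := ‖(U s)ᴴ * A * U s * B - B * ((U s)ᴴ * A * U s)‖ with hL
  -- every term of the series carries a factor `a`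
  have hscale : ∀ n : ℕ, (2 * (a * J) * s) ^ n = (a * (c * s)) ^ n := fun n => by
    rw [hc]; ring
  have hN : ∀ N : ℕ, L ≤ 2 * ‖A‖ * ‖B‖ * ((#X : ℝ) * (a *
      ((Real.exp (-(μ * δ X)) * Real.exp (Real.exp μ * (c * s)) + (c * s) ^ (N + 1) / (N + 1)!) +
        κ * (Real.exp (c * s) + (c * s) ^ (N + 1) / (N + 1)!)))) := by
    intro N
    have h := norm_comm_flow_le_iterate_weighted hΨ hΨc hU0 hU hU1 hU2 hB δ hδY hδ haJ0 hJ hκ hJ'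
      N X A hA s hs
    rw [if_neg (Nat.pos_iff_ne_zero.mp hX), zero_add,
      show max 1 (δ X) = δ X from max_eq_right hX, show max 1 1 = 1 from max_self 1] at h
    simp only [hscale] at h
    refine h.trans (mul_le_mul_of_nonneg_left (mul_le_mul_of_nonneg_left ?_ (by positivity))
      (by positivity))
    -- compare the bracket
    have h1 : ∑ n ∈ Finset.Icc (δ X) N, (a * (c * s)) ^ n / n ! +
        (a * (c * s)) ^ (N + 1) / (N + 1)! ≤
        a * (Real.exp (-(μ * δ X)) * Real.exp (Real.exp μ * (c * s)) + (c * s) ^ (N + 1) / (N + 1)!) := by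
      have e1 := sum_Icc_pow_mul_div_factorial_le_mul ha0 ha1 hcs hX N
      have e2 := pow_mul_div_factorial_le_mul ha0 ha1 hcs (n := N + 1) (by omega)
      have e3 := sum_Icc_pow_div_factorial_le hcs hμ (δ X) N
      rw [mul_add]
      exact add_le_add (e1.trans (mul_le_mul_of_nonneg_left e3 ha0)) e2
    have h2 : ∑ n ∈ Finset.Icc 1 N, (a * (c * s)) ^ n / n ! +
        (a * (c * s)) ^ (N + 1) / (N + 1)! ≤ a * (Real.exp (c * s) + (c * s) ^ (N + 1) / (N + 1)!) := by
      have e1 := sum_Icc_pow_mul_div_factorial_le_mul ha0 ha1 hcs le_rfl N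
      have e2 := pow_mul_div_factorial_le_mul ha0 ha1 hcs (n := N + 1) (by omega)
      have e3 := sum_Icc_pow_div_factorial_le hcs le_rfl 1 N
      simp only [Nat.cast_one, mul_one, neg_zero, Real.exp_zero, one_mul] at e3
      rw [mul_add]
      exact add_le_add (e1.trans (mul_le_mul_of_nonneg_left e3 ha0)) e2
    calc ∑ n ∈ Finset.Icc (δ X) N, (a * (c * s)) ^ n / n ! + (a * (c * s)) ^ (N + 1) / (N + 1)! +
          κ * (∑ n ∈ Finset.Icc 1 N, (a * (c * s)) ^ n / n ! + (a * (c * s)) ^ (N + 1) / (N + 1)!)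
        ≤ a * (Real.exp (-(μ * δ X)) * Real.exp (Real.exp μ * (c * s)) + (c * s) ^ (N + 1) / (N + 1)!) +
          κ * (a * (Real.exp (c * s) + (c * s) ^ (N + 1) / (N + 1)!)) :=
          add_le_add h1 (mul_le_mul_of_nonneg_left h2 hκ)
      _ = a * ((Real.exp (-(μ * δ X)) * Real.exp (Real.exp μ * (c * s)) + (c * s) ^ (N + 1) / (N + 1)!) +
          κ * (Real.exp (c * s) + (c * s) ^ (N + 1) / (N + 1)!)) := by ring
  have hlim : Tendsto (fun N : ℕ => 2 * ‖A‖ * ‖B‖ * ((#X : ℝ) * (a *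
      ((Real.exp (-(μ * δ X)) * Real.exp (Real.exp μ * (c * s)) + (c * s) ^ (N + 1) / (N + 1)!) +
        κ * (Real.exp (c * s) + (c * s) ^ (N + 1) / (N + 1)!))))) atTop
      (𝓝 (2 * ‖A‖ * ‖B‖ * ((#X : ℝ) * (a *
        ((Real.exp (-(μ * δ X)) * Real.exp (Real.exp μ * (c * s)) + 0) +
          κ * (Real.exp (c * s) + 0)))))) := by
    have h0 : Tendsto (fun N : ℕ => (c * s) ^ (N + 1) / (N + 1)!) atTop (𝓝 0) :=
      (FloorSemiring.tendsto_pow_div_factorial_atTop (c * s)).comp (tendsto_add_atTop_nat 1)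
    exact tendsto_const_nhds.mul (tendsto_const_nhds.mul (tendsto_const_nhds.mul
      ((tendsto_const_nhds.add h0).add (tendsto_const_nhds.mul (tendsto_const_nhds.add h0)))))
  have hle := ge_of_tendsto' hlim hN
  rw [add_zero, add_zero] at hle
  refine hle.trans (le_of_eq ?_)
  rw [Real.exp_add, hc]
  ring_nf

end Lattice

end Literature.MathematicalPhysics.QuantumLattice
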